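import Summits.QuantumFields.BalabanUV.T4Continuum.Support.TermwiseLevels

/-!
# TermwiseLevelsLedger — generation 9's six binders (U)(L) PRODUCED from LEVEL-GRADED one-step regularity under the
WINDOW CLAUSE, and the term-wise ledger theorem called ONCE: `GoodClause ∧ Summable δ⁗` for the I-3 good class's
action kind, with the action share `w₀·(dU_K + dL_K)` an explicit WINDOWED geometric majorant

Cell `pub-balaban`, rung (B)+1 sub-cell t4, lineage `b2b-balaban-t4-ne7-p1` (node U5 = NE7, TERM-WISE member;
generation 17), record `t4/T4-EST-NE7-P1.md` §21 (21a); companion of `Support/TermwiseLevels`.  HONEST FRAMING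
(page 1): FIXED FINITE T⁴, rung (B)+1 = the `ε → 0` limit of unit-scale averaged expectations, CONDITIONAL on
BetaPertH and the nine spine estimates (0/9 proved); NOT infinite volume, NOT a mass gap, NOT the Clay problem.  NE7
is NOT PRINTED in [Balaban1984PropagatorsI]–[Balaban1989LargeFieldII] and NOT proved here: every estimate below is a
HYPOTHESIS BINDER named in the statement; the flow window (0.31) of [Balaban1987RG1] (the cell's BetaPertH road)
enters BY NAME as `h031A`/`h031B`, (B)/(B^μ) sit by name inside the producers of the upstream ledger kinds exactly
where those modules declare them; nothing is hidden in a definition.  [folklore] bookkeeping; no definitions, no cite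
tags; nothing printed is asserted.

WHY (record (20l)(γ)).  Generations 9–16 fed the action kind of the two-run ledger from ONE classical step with radii
UNIFORM over the torus at cutoff `K` — the all-small-field (King-type) history.  Under the cell's crossover interface
I-3 a GOOD history may carry YOUNG rough windows (regularity level `j` with `jlogOf Cl K ≤ j ≤ K`); generation 16
showed that the level-graded majorant is then still summable (`TermwiseHeterogeneousWindow`).  This module THREADS
that through the ledger: §10 is generation 10's producer `interpolation_averaging_of_regular` with POSITION-DEPENDENT
radii read off displayed LEVEL MAPS under a displayed WINDOW CLAUSE, §11 is generation 9's ledger theorem called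
once with §10's output.  With the all-top-level maps (`TermwiseLevels.recentOnly_top`) §10's hypotheses are
generation 10's uniform ones and the majorant differs from generation 10's `(L⁻²)^K` by the factor
`windowSum/θ^K = poly(K)` only (`TermwiseLevels.windowedMajorant_le_poly`).

WHAT IS PROVED ([folklore]).
§10 `interpolation_averaging_of_levels` — OUTPUT: (U) `f₁(yA) − g(xA) ≤ vol·dU_K`, (L) `g(Q yB) − f₁(yB) ≤ vol·dL_K`
    on every good term's admissible data, `0 ≤ dU_K, dL_K`, `Σ dU_K, Σ dL_K < ∞`, with
    `dU_K = n₀·C_U·windowSum L⁻² L⁴ (jlogOf Cl K) K`, `dL_K = n₀·C_L·windowSum L⁻² L⁴ (jlogOf Cl K) K`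
    (`C_U = cU q₄ c₁ c₂ c₃ ε₁` of generation 16, `C_L = c₁c₃ε₁³ + c₃²ε₁⁴/2 + q₄c₁⁴ε₁⁴` of generation 10);
    from `TermwiseHeterogeneous.interpolationError_le_levels` (U) and `TermwiseLevels.averagingError_le_levels` (L)
    per term, the level shares from the plaquette counts alone (`levelCount_coarse_le`/`levelCount_fine_le`), the
    sum of shares = the tree's window sum, summability = the tree's `summable_windowSum_log` (every `θ < 1`).
§11 `goodClause_summable_of_kindsRA_levels` — ONE CALL of `T4TermwiseClassical.goodClause_summable_of_kindsRA_lift`.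

BINDER CENSUS of §11 (every one a hypothesis; which are estimates).  As generation 10's
`goodClause_summable_of_kindsRA_regular` — its census (T)(B-T)(R-T)(F)(F′)(S)(M)(M-B)(B-adm)(B-win)(N)(Q)(R-sc)(M-R)
(R-S)(0.31)(min-A)(Q)(lift)(min-B)(act)(γ)(R-w)(W-w) and (wt)(ker)(cnt)(repr-U)(tr-U)(repr-L)(tr-L) VERBATIM — with
the uniform (bch-U)(sz-U)(osc-U)(bch-L)(sz-L)(scal) replaced by:
(lvl) `lvlA`, `lvlB` (windows), `lvlBf` (fine plaquettes) — the regularity LEVEL MAPS of the lift of run A's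
  background and of run B's background on each good term's datum (DATA of the history: which window lies in which
  domain `Ω_j ∖ Ω_{j+1}` of the run's sequence; supplied by nodes U5a/U5c, not estimated here);
(win-U)(win-L)(win-Lf) `hwinA hwinB hwinBf` — THE WINDOW CLAUSE `RecentOnly (P· K) (lvl· K t τ v) (jlogOf Cl K) K`
  with the SAME cut as the boundary kind's (B-win) `hBwin`: in a good term every level is young; interface I-3 of the
  cell (T4-DAG node U5c) — a DEFINITION of the hybrid's bad class `Bad K t` (it must contain every history with pending
  structure older than the cut; its smallness is the weight half, NE7b), NOT PRINTED, not an estimate;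
(bch-U)(bch-L) `hρA hρB` — BCH remainder `≤ ρb_{lvl y}` on the window of `y` (LOCATED: [Balaban1985Averaging] Prop. 1
  (51) p. 26, second-order term; ESTIMATE, per level);
(sz-U)(sz-L)(sz-Lf) `hsA hsB hsBf` — plaquette fields of size `≤ sz_{lvl}` window-wise, and fine-plaquette-wise for
  run B (LOCATED in shape: [Balaban1985Variational] conditions (2) p. 278 on the domains `Ω_j`, one run; for
  multi-domain backgrounds [Balaban1989LargeFieldII] p. 361; ESTIMATES for both runs' backgrounds and the lift);
(osc-U) `hoscA` — the lift's transported field oscillates by `≤ ω_{lvl y}` over the window of `y` (NOT PRINTED; the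
  binder that carries the rate, generation 10's census; ESTIMATE, per level);
(scal) `hsz hω hρb` — the size laws PER LEVEL `sz_j ≤ c₁ε₁L^{−2(j+1)}`, `ω_j ≤ c₂ε₁L^{−2(j+1)}L^{−j}`,
  `ρb_j ≤ c₃ε₁²L^{−4j}` (generation 10's laws with `K ↦ j`; ESTIMATES); `hCl : 0 ≤ Cl` is shared with (B-win).
OUTPUT: the good clause with `δ⁗_K` explicit — its action-kind share is
`w₀·(n₀·C_U·windowSum L⁻² L⁴ (jlogOf Cl K) K + n₀·C_L·windowSum L⁻² L⁴ (jlogOf Cl K) K)` — and `Summable δ⁗`.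

NOT DELIVERED: any instantiation of the level maps or of (bch)(sz)(osc)(scal) on Bałaban's configurations; the
level-graded LOCALISATION of generations 11–16's U(N) producers (per-window gauge truncation, (44)/(44∇) from
per-level `HolderReg`, `hol_congr_of_ball`) — the lineage's next step, after which `hA9`/`hB9` are asked per level on
young windows only; the coupling-lag species of the main action on old HEALED islands ([Balaban1988Convergent] (2.24);
`K`-uniform profile, `TermwiseHeterogeneous.summable_of_levels` applies verbatim; its island clause is a weight-half
input); anything about print.  Value = the ledger now accepts level-graded one-step regularity under the displayed
window clause; NOT NE7, NOT summit progress.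

References (LOCATIONS only): [Balaban1987RG1] T. Bałaban, Renormalization group approach to lattice gauge field
theories. I, Commun. Math. Phys. 109 (1987) 249–301, (0.31) p. 259; [Balaban1985Averaging] Commun. Math. Phys. 98
(1985) 17–51, Prop. 1 (51) p. 26; [Balaban1985Variational] Commun. Math. Phys. 102 (1985) 277–309, conditions (2)
p. 278; [Balaban1989LargeFieldII] Commun. Math. Phys. 122 (1989) 355–392, p. 361; [Balaban1988Convergent] T. Bałaban,
Convergent renormalization expansions for lattice gauge theories, Commun. Math. Phys. 119 (1988) 243–285, (2.24)
p. 259.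
-/

noncomputable section

open Finset MeasureTheory _root_.Filter _root_.Topology
open scoped BigOperators

namespace Summit.QuantumFields.BalabanUV.T4Continuum.TermwiseLevels

open Literature.MathematicalPhysics.QuantumFieldTheory.Balaban1983to89
open T4OutputRate T4RecentScale T4GoodClassBudget T4CauchySum T4Crossover T4TowerRateComposition T4TowerRateDischarge
open T4BoundaryCarrier (BFunctional atFl NE9Fl LipBackgroundFl NE5B)
open T4TermwiseBudget T4TermwiseDeviation T4TermwiseCurrency T4TermwiseBoundary T4TermwiseResidual T4TermwiseAction
open T4TermwiseClassical T4TermwiseQuartic TermwiseHeterogeneous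

/-! ## §10 (U) and (L) PRODUCED along the tower from LEVEL-GRADED radii under the window clause -/

section Indexed

variable {V : Type*} [NormedAddCommGroup V] [InnerProductSpace ℝ V] {Xf Xc : Type*} {ι : Type} {σ : Type*}
  [DecidableEq σ] {l₀ vol : ℝ} {T : ℕ → Finset σ} {Bad : ℕ → ℝ → Finset σ} {Adm : Set ι}

/-- **(U)(L) PRODUCED FROM LEVEL-GRADED ONE-STEP REGULARITY UNDER THE WINDOW CLAUSE.**  Generation 10's producer
`T4TermwiseQuartic.interpolation_averaging_of_regular` with its UNIFORM radii (sz-U)(osc-U)(bch-U)(sz-L)(bch-L)(scal)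
replaced by POSITION-DEPENDENT ones: every good term's admissible datum carries LEVEL MAPS — `lvlA` on the windows
`Pc K` of the lift of run A's background, `lvlB` on the windows and `lvlBf` on the fine plaquettes `Pf K` of run B's
background — and on a window (resp. fine plaquette) of level `j` the radii are the level-`j` ones: field size `sz_j`,
window oscillation `ω_j`, BCH remainder `ρb_j`, with generation 10's size laws AT SCALE `L^{−j}`
(`sz_j ≤ c₁ε₁L^{−2(j+1)}`, `ω_j ≤ c₂ε₁L^{−2(j+1)}L^{−j}`, `ρb_j ≤ c₃ε₁²L^{−4j}`; at `j = K` exactly generation 10's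
`s_K, ω_K, ρb_K`).  THE WINDOW CLAUSE (Q-Bad, displayed; the cell's crossover interface I-3 with the ledger's cut
`jlogOf Cl K`): in a GOOD term every level lies in the logarithmic window, `RecentOnly (Pc K) (lvl· K t τ v)
(jlogOf Cl K) K` — structure older than the cut is healed (level `K` again) or the term is in `Bad K t`.  The other
binders (wt)(ker)(cnt)(repr-U)(tr-U)(repr-L)(tr-L) are generation 10's, verbatim.  OUTPUT: generation 9's six binders
(U) `hUdev hdU0 hdU`, (L) `hLdev hdL0 hdL` with the WINDOWED majorants
`dU_K = n₀·C_U(ε₁)·windowSum L⁻² L⁴ (jlogOf Cl K) K`, `dL_K = n₀·C_L(ε₁)·windowSum L⁻² L⁴ (jlogOf Cl K) K`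
(`C_U = cU q₄ c₁ c₂ c₃ ε₁`, `C_L = c₁c₃ε₁³ + c₃²ε₁⁴/2 + q₄c₁⁴ε₁⁴`), the level shares being bounded by the plaquette
counts alone (`≤ Λ^{K−j}` per term, `levelCount_coarse_le`/`levelCount_fine_le`), and their summability by the tree's
`summable_windowSum_log` (every `θ < 1`; here `θ = L⁻²`).  [folklore] -/
theorem interpolation_averaging_of_levels {Y YA : Type*} {g : ℕ → ℝ → σ → ι → YA → ℝ}
    {f₁ : ℕ → ℝ → σ → ι → Y → ℝ} {Q : ℕ → ℝ → σ → ι → Y → YA} {yA yB : ℕ → ℝ → σ → ι → Y}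
    {xA : ℕ → ℝ → σ → ι → YA} {Pf : ℕ → Finset Xf} {Pc : ℕ → Finset Xc} {w : ℕ → Xc → Xf → ℝ} {e : V → ℝ}
    {φA φB : ℕ → ℝ → σ → ι → Xf → V} {ψA ψB : ℕ → ℝ → σ → ι → Xc → V} {ΦA ΦB : ℕ → ℝ → σ → ι → Xc → Xf → V}
    {lvlA lvlB : ℕ → ℝ → σ → ι → Xc → ℕ} {lvlBf : ℕ → ℝ → σ → ι → Xf → ℕ}
    {q₄ L n₀ c₁ c₂ c₃ ε₁ Cl : ℝ} {sz ω ρb : ℕ → ℝ}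
    (he : ∀ v, ‖v‖ ^ 2 / 2 - q₄ * ‖v‖ ^ 4 ≤ e v ∧ e v ≤ ‖v‖ ^ 2 / 2) (hq₄ : 0 ≤ q₄) (hL : 1 < L)
    (hw : ∀ K, ∀ y ∈ Pc K, ∀ x ∈ Pf K, 0 ≤ w K y x) (hrow : ∀ K, ∀ y ∈ Pc K, ∑ x ∈ Pf K, w K y x = L ^ 2)
    (hcol : ∀ K, ∀ x ∈ Pf K, ∑ y ∈ Pc K, w K y x = (L ^ 2)⁻¹) (hn₀ : 0 ≤ n₀) (hvol : 0 ≤ vol)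
    (hNf : ∀ K, ((Pf K).card : ℝ) ≤ n₀ * vol * (L ^ (K + 1)) ^ 4)
    (hNc : ∀ K, ((Pc K).card : ℝ) ≤ n₀ * vol * (L ^ K) ^ 4)
    (hreprU : ∀ K t, |t| ≤ l₀ → ∀ τ ∈ T K \ Bad K t, ∀ v ∈ Adm,
      f₁ K t τ v (yA K t τ v) = ∑ x ∈ Pf K, e (φA K t τ v x) ∧
        g K t τ v (xA K t τ v) = ∑ y ∈ Pc K, e (ψA K t τ v y))
    (hΦA : ∀ K t, |t| ≤ l₀ → ∀ τ ∈ T K \ Bad K t, ∀ v ∈ Adm, ∀ y ∈ Pc K, ∀ x ∈ Pf K,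
      ‖ΦA K t τ v y x‖ = ‖φA K t τ v x‖)
    (hwinA : ∀ K t, |t| ≤ l₀ → ∀ τ ∈ T K \ Bad K t, ∀ v ∈ Adm, RecentOnly (Pc K) (lvlA K t τ v) (jlogOf Cl K) K)
    (hρA : ∀ K t, |t| ≤ l₀ → ∀ τ ∈ T K \ Bad K t, ∀ v ∈ Adm, ∀ y ∈ Pc K,
      ‖ψA K t τ v y - ∑ x ∈ Pf K, w K y x • ΦA K t τ v y x‖ ≤ ρb (lvlA K t τ v y))
    (hsA : ∀ K t, |t| ≤ l₀ → ∀ τ ∈ T K \ Bad K t, ∀ v ∈ Adm, ∀ y ∈ Pc K, ∀ x ∈ Pf K,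
      0 < w K y x → ‖φA K t τ v x‖ ≤ sz (lvlA K t τ v y))
    (hoscA : ∀ K t, |t| ≤ l₀ → ∀ τ ∈ T K \ Bad K t, ∀ v ∈ Adm, ∀ y ∈ Pc K, ∀ x ∈ Pf K, ∀ x' ∈ Pf K,
      0 < w K y x → 0 < w K y x' → ‖ΦA K t τ v y x - ΦA K t τ v y x'‖ ≤ ω (lvlA K t τ v y))
    (hreprL : ∀ K t, |t| ≤ l₀ → ∀ τ ∈ T K \ Bad K t, ∀ v ∈ Adm,
      f₁ K t τ v (yB K t τ v) = ∑ x ∈ Pf K, e (φB K t τ v x) ∧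
        g K t τ v (Q K t τ v (yB K t τ v)) = ∑ y ∈ Pc K, e (ψB K t τ v y))
    (hΦB : ∀ K t, |t| ≤ l₀ → ∀ τ ∈ T K \ Bad K t, ∀ v ∈ Adm, ∀ y ∈ Pc K, ∀ x ∈ Pf K,
      ‖ΦB K t τ v y x‖ = ‖φB K t τ v x‖)
    (hwinB : ∀ K t, |t| ≤ l₀ → ∀ τ ∈ T K \ Bad K t, ∀ v ∈ Adm, RecentOnly (Pc K) (lvlB K t τ v) (jlogOf Cl K) K)
    (hwinBf : ∀ K t, |t| ≤ l₀ → ∀ τ ∈ T K \ Bad K t, ∀ v ∈ Adm,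
      RecentOnly (Pf K) (lvlBf K t τ v) (jlogOf Cl K) K)
    (hρB : ∀ K t, |t| ≤ l₀ → ∀ τ ∈ T K \ Bad K t, ∀ v ∈ Adm, ∀ y ∈ Pc K,
      ‖ψB K t τ v y - ∑ x ∈ Pf K, w K y x • ΦB K t τ v y x‖ ≤ ρb (lvlB K t τ v y))
    (hsB : ∀ K t, |t| ≤ l₀ → ∀ τ ∈ T K \ Bad K t, ∀ v ∈ Adm, ∀ y ∈ Pc K, ∀ x ∈ Pf K,
      0 < w K y x → ‖φB K t τ v x‖ ≤ sz (lvlB K t τ v y))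
    (hsBf : ∀ K t, |t| ≤ l₀ → ∀ τ ∈ T K \ Bad K t, ∀ v ∈ Adm, ∀ x ∈ Pf K, ‖φB K t τ v x‖ ≤ sz (lvlBf K t τ v x))
    (hc₁ : 0 ≤ c₁) (hc₃ : 0 ≤ c₃) (hε₁ : 0 ≤ ε₁) (hCl : 0 ≤ Cl)
    (hsz : ∀ j, 0 ≤ sz j ∧ sz j ≤ c₁ * ε₁ * ((L ^ (j + 1))⁻¹) ^ 2)
    (hω : ∀ j, 0 ≤ ω j ∧ ω j ≤ c₂ * ε₁ * ((L ^ (j + 1))⁻¹) ^ 2 * (L ^ j)⁻¹)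
    (hρb : ∀ j, 0 ≤ ρb j ∧ ρb j ≤ c₃ * ε₁ ^ 2 * ((L ^ j)⁻¹) ^ 4) :
    (∀ K t, |t| ≤ l₀ → ∀ τ ∈ T K \ Bad K t, ∀ v ∈ Adm,
      f₁ K t τ v (yA K t τ v) - g K t τ v (xA K t τ v)
        ≤ vol * (n₀ * cU q₄ c₁ c₂ c₃ ε₁ * windowSum ((L ^ 2)⁻¹) (L ^ 4) (jlogOf Cl K) K)) ∧
    (∀ K t, |t| ≤ l₀ → ∀ τ ∈ T K \ Bad K t, ∀ v ∈ Adm,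
      g K t τ v (Q K t τ v (yB K t τ v)) - f₁ K t τ v (yB K t τ v)
        ≤ vol * (n₀ * (c₁ * c₃ * ε₁ ^ 3 + c₃ ^ 2 * ε₁ ^ 4 / 2 + q₄ * (c₁ ^ 4 * ε₁ ^ 4))
          * windowSum ((L ^ 2)⁻¹) (L ^ 4) (jlogOf Cl K) K)) ∧
    (∀ K, 0 ≤ n₀ * cU q₄ c₁ c₂ c₃ ε₁ * windowSum ((L ^ 2)⁻¹) (L ^ 4) (jlogOf Cl K) K) ∧
    (∀ K, 0 ≤ n₀ * (c₁ * c₃ * ε₁ ^ 3 + c₃ ^ 2 * ε₁ ^ 4 / 2 + q₄ * (c₁ ^ 4 * ε₁ ^ 4))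
      * windowSum ((L ^ 2)⁻¹) (L ^ 4) (jlogOf Cl K) K) ∧
    Summable (fun K => n₀ * cU q₄ c₁ c₂ c₃ ε₁ * windowSum ((L ^ 2)⁻¹) (L ^ 4) (jlogOf Cl K) K) ∧
    Summable (fun K => n₀ * (c₁ * c₃ * ε₁ ^ 3 + c₃ ^ 2 * ε₁ ^ 4 / 2 + q₄ * (c₁ ^ 4 * ε₁ ^ 4))
      * windowSum ((L ^ 2)⁻¹) (L ^ 4) (jlogOf Cl K) K) := by
  obtain ⟨hθ0, hθ1, hΛ1⟩ := rate_facts hL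
  have hΛ0 : (0 : ℝ) ≤ L ^ 4 := zero_le_one.trans hΛ1
  have hCU : 0 ≤ cU q₄ c₁ c₂ c₃ ε₁ := cU_nonneg hq₄ hc₁ hc₃ hε₁
  have hCL : 0 ≤ c₁ * c₃ * ε₁ ^ 3 + c₃ ^ 2 * ε₁ ^ 4 / 2 + q₄ * (c₁ ^ 4 * ε₁ ^ 4) := by positivity
  have hW : ∀ K, 0 ≤ windowSum ((L ^ 2)⁻¹) (L ^ 4) (jlogOf Cl K) K := fun K => windowSum_nonneg hθ0.le hΛ0 _ _
  have hsum := summable_windowSum_log hθ0 hθ1 hΛ1 hCl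
  -- the level shares of the window clause and their sum
  have hμ0 : ∀ K j, 0 ≤ (if jlogOf Cl K ≤ j then (L ^ 4) ^ (K - j) else (0 : ℝ)) := fun K j => by
    split_ifs
    · exact pow_nonneg hΛ0 _
    · exact le_rfl
  have hS : ∀ K, ∑ j ∈ Finset.range (K + 1), (if jlogOf Cl K ≤ j then (L ^ 4) ^ (K - j) else (0 : ℝ))
      * ((L ^ 2)⁻¹) ^ j ≤ windowSum ((L ^ 2)⁻¹) (L ^ 4) (jlogOf Cl K) K :=
    fun K => sum_shares_le_windowSum hθ0.le _ _
  refine ⟨fun K t ht τ hτ v hv => ?_, fun K t ht τ hτ v hv => ?_, fun K => mul_nonneg (mul_nonneg hn₀ hCU) (hW K),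
    fun K => mul_nonneg (mul_nonneg hn₀ hCL) (hW K), hsum.mul_left _, hsum.mul_left _⟩
  · obtain ⟨e1, e2⟩ := hreprU K t ht τ hτ v hv
    have hrec := hwinA K t ht τ hτ v hv
    have key := interpolationError_le_levels (Pf K) (Pc K) (lvl := lvlA K t τ v) (K := K)
      (N := fun j => (((Pc K).filter (fun y => lvlA K t τ v y = j)).card : ℝ))
      (μ := fun j => if jlogOf Cl K ≤ j then (L ^ 4) ^ (K - j) else (0 : ℝ))
      he hq₄ hL (hw K) (hrow K) (hcol K) (hΦA K t ht τ hτ v hv) (fun y hy => (hrec y hy).2)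
      (hsA K t ht τ hτ v hv) (hoscA K t ht τ hτ v hv) (hρA K t ht τ hτ v hv) hn₀ hvol hc₁ hc₃ hε₁ hsz hω hρb
      (hμ0 K) (fun j => Nat.cast_nonneg _) (fun j _ => le_rfl)
      (fun j hj => levelCount_coarse_le (Pc K) (lvlA K t τ v) hL hj hrec (hNc K))
    rw [e1, e2]
    exact key.trans (mul_le_mul_of_nonneg_left (mul_le_mul_of_nonneg_left (hS K) (mul_nonneg hn₀ hCU)) hvol)
  · obtain ⟨e1, e2⟩ := hreprL K t ht τ hτ v hv
    have hrec := hwinB K t ht τ hτ v hv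
    have hrecf := hwinBf K t ht τ hτ v hv
    have key := averagingError_le_levels (Pf K) (Pc K) (lvl := lvlB K t τ v) (lvlf := lvlBf K t τ v) (K := K)
      (Nc := fun j => (((Pc K).filter (fun y => lvlB K t τ v y = j)).card : ℝ))
      (Nf := fun j => (((Pf K).filter (fun x => lvlBf K t τ v x = j)).card : ℝ))
      (μ := fun j => if jlogOf Cl K ≤ j then (L ^ 4) ^ (K - j) else (0 : ℝ))
      he hq₄ hL (hw K) (hrow K) (hcol K) (hΦB K t ht τ hτ v hv) (fun y hy => (hrec y hy).2)
      (fun x hx => (hrecf x hx).2) (hsB K t ht τ hτ v hv) (hsBf K t ht τ hτ v hv) (hρB K t ht τ hτ v hv)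
      hn₀ hvol hc₁ hc₃ hε₁ hsz hρb (hμ0 K) (fun j => Nat.cast_nonneg _) (fun j => Nat.cast_nonneg _)
      (fun j _ => le_rfl) (fun j _ => le_rfl)
      (fun j hj => levelCount_coarse_le (Pc K) (lvlB K t τ v) hL hj hrec (hNc K))
      (fun j hj => levelCount_fine_le (Pf K) (lvlBf K t τ v) hL hj hrecf (hNf K))
    rw [e1, e2]
    exact key.trans (mul_le_mul_of_nonneg_left (mul_le_mul_of_nonneg_left (hS K) (mul_nonneg hn₀ hCL)) hvol)

end Indexed

/-! ## §11 The ledger theorem: the good-class half with `Summable δ⁗`, the action kind from LEVEL-GRADED one-step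
regularity under the window clause (ONE CALL of generation 9's `goodClause_summable_of_kindsRA_lift`) -/

section Ledger

variable {C : T4BoundaryCarrier.Carriers} {ι : Type} [MeasurableSpace ι] {σ : Type*} [DecidableEq σ] {l₀ vol : ℝ}
  {T : ℕ → Finset σ} {Bad : ℕ → ℝ → Finset σ} {A B : ℕ → ℝ → σ → ℝ} {μ : ℕ → ℝ → σ → Measure ι}
  {fac bfac rfac : ℕ → ℝ → σ → Finset C.Dom} {Adm : Set ι} {EA : Functional C.toCarriers C.BgA}
  {EB : Functional C.toCarriers C.BgB} {BA : BFunctional C C.BgA} {BB : BFunctional C C.BgB}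
  {RA : Functional C.toCarriers C.BgA} {RB : Functional C.toCarriers C.BgB}
  {κ θ' Cr EB₀ CrR R₁ b β' w₀ : ℝ} {κ₀ : ℕ} {gA gB : ℕ → ℕ → ℝ} {gfA gfB : ℕ → ℝ} {gsA gsB : ℕ → ℕ → ℝ}
  {uA : ℕ → ι → C.BgA} {uB : ℕ → ι → C.BgB} {oneA : C.BgA} {oneB : C.BgB}
  {pend : ℕ → ℝ → σ → ι → C.Fl} {nA nB aA aB wA wB γA γB : ℕ → ℝ → σ → ι → ℝ} {qA qB : ℕ → ℝ}
  {κ₁ S : ℕ → ℝ → σ → ℕ → ℝ} {cW RW : ℕ → ℝ → σ → ℝ} {rw sw rγ zA zB c₀ : ℕ → ℝ} {Cw E a Λ Cl : ℝ}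
  {V : Type*} [NormedAddCommGroup V] [InnerProductSpace ℝ V] {Xf Xc : Type*}

/-- **THE GOOD-CLASS HALF WITH `Summable δ⁗`, (U)(L) PRODUCED FROM LEVEL-GRADED ONE-STEP REGULARITY UNDER THE WINDOW
CLAUSE.**  Generation 9's `goodClause_summable_of_kindsRA_lift` (all its binders BY NAME and VERBATIM: composed E-rate
`hUR`, boundary rate family `hURB`, 𝐑-rate family `hURR`, format (F), sizes (S), multiplicities (M)(M-B)(M-R), witness
(F′), (B-adm)(B-win), one-sided sizes (N), constants (Q), 𝐑-slice sizes (R-S), the flow window (0.31) of both coupling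
tables `h031A`/`h031B`, (min-A)(Q)(lift)(min-B)(act)(γ)(R-w)(W-w)), with (U) `hUdev hdU0 hdU` and (L) `hLdev hdL0
hdL` REPLACED by the binders of `interpolation_averaging_of_levels`: (wt)(ker)(cnt)(repr-U)(tr-U)(repr-L)(tr-L) as in
generation 10; the WINDOW CLAUSES (win-U) `hwinA`, (win-L) `hwinB`, (win-Lf) `hwinBf` (`RecentOnly … (jlogOf Cl K) K`
— the SAME logarithmic cut as the boundary kind's (B-win) `hBwin`); the LEVEL-GRADED radii (bch-U) `hρA`, (sz-U)
`hsA`, (osc-U) `hoscA`, (bch-L) `hρB`, (sz-L) `hsB`, (sz-Lf) `hsBf`; the size laws (scal) `hsz hω hρb` PER LEVEL.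
OUTPUT: the good clause with generation 9's `δ⁗` in which `dU_K + dL_K` is the EXPLICIT WINDOWED majorant
`n₀·C_U·windowSum L⁻² L⁴ (jlogOf Cl K) K + n₀·C_L·windowSum L⁻² L⁴ (jlogOf Cl K) K`, and its summability.  No print is
used as a fact; nothing printed is asserted; NOT NE7, NOT Clay. [folklore] -/
theorem goodClause_summable_of_kindsRA_levels {Y YA : Type*} {Sfib : ℕ → ℝ → σ → ι → Set Y}
    {SfibA : ℕ → ℝ → σ → ι → Set YA} {g : ℕ → ℝ → σ → ι → YA → ℝ} {f₁ : ℕ → ℝ → σ → ι → Y → ℝ}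
    {Q : ℕ → ℝ → σ → ι → Y → YA} {yA yB : ℕ → ℝ → σ → ι → Y} {xA : ℕ → ℝ → σ → ι → YA}
    {Pf : ℕ → Finset Xf} {Pc : ℕ → Finset Xc} {w : ℕ → Xc → Xf → ℝ} {e : V → ℝ}
    {φA φB : ℕ → ℝ → σ → ι → Xf → V} {ψA ψB : ℕ → ℝ → σ → ι → Xc → V} {ΦA ΦB : ℕ → ℝ → σ → ι → Xc → Xf → V}
    {lvlA lvlB : ℕ → ℝ → σ → ι → Xc → ℕ} {lvlBf : ℕ → ℝ → σ → ι → Xf → ℕ}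
    {q₄ L n₀ c₁ c₂ c₃ ε₁ : ℝ} {sz ω ρb : ℕ → ℝ}
    (hUR : ∀ K, URateUpTo K EA EB (gA K) (gB K) (uA K) (uB K) Adm Cr θ' κ) (hCr : 0 ≤ Cr)
    (hθ'0 : 0 < θ') (hθ'1 : θ' < 1) (hθ'Λ : θ' ≤ Λ) (hΛ1 : 1 ≤ Λ) (hCl : 0 ≤ Cl)
    (hURB : ∀ b ∈ C.admFl, ∀ K, URateUpTo K (atFl BA b) (atFl BB b) (gA K) (gB K) (uA K) (uB K) Adm EB₀ θ' κ)
    (hEB₀ : 0 ≤ EB₀)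
    (hURR : ∀ K, URateUpTo K RA RB (gA K) (gB K) (uA K) (uB K) Adm CrR θ' κ) (hCrR : 0 ≤ CrR)
    (hfmtA : ∀ K t τ, A K t τ = ∫ v, (∏ X ∈ fac K t τ,
      Real.exp (EA (gA K) (uA K v) X - EA (gA K) oneA X)) *
        ((∏ X ∈ bfac K t τ, Real.exp (BA (gA K) (uA K v) (pend K t τ v) X)) * nA K t τ v * qA K *
          ((∏ X ∈ rfac K t τ, Real.exp (RA (gA K) (uA K v) X - RA (gA K) oneA X)) * (Real.exp (-aA K t τ v) * wA K t τ v)))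
          ∂(μ K t τ))
    (hfmtB : ∀ K t τ, B K t τ = ∫ v, (∏ X ∈ fac K t τ,
      Real.exp (EB (gB K) (uB K v) X - EB (gB K) oneB X)) *
        ((∏ X ∈ bfac K t τ, Real.exp (BB (gB K) (uB K v) (pend K t τ v) X)) * nB K t τ v * qB K *
          ((∏ X ∈ rfac K t τ, Real.exp (RB (gB K) (uB K v) X - RB (gB K) oneB X)) * (Real.exp (-aB K t τ v) * wB K t τ v)))
          ∂(μ K t τ))
    (hint : ∀ K t, |t| ≤ l₀ → ∀ τ ∈ T K \ Bad K t,
      Integrable (fun v => (∏ X ∈ fac K t τ, Real.exp (EA (gA K) (uA K v) X - EA (gA K) oneA X)) *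
        ((∏ X ∈ bfac K t τ, Real.exp (BA (gA K) (uA K v) (pend K t τ v) X)) * nA K t τ v * qA K *
          ((∏ X ∈ rfac K t τ, Real.exp (RA (gA K) (uA K v) X - RA (gA K) oneA X)) * (Real.exp (-aA K t τ v) * wA K t τ v))))
          (μ K t τ) ∧
      Integrable (fun v => (∏ X ∈ fac K t τ, Real.exp (EB (gB K) (uB K v) X - EB (gB K) oneB X)) *
        ((∏ X ∈ bfac K t τ, Real.exp (BB (gB K) (uB K v) (pend K t τ v) X)) * nB K t τ v * qB K *
          ((∏ X ∈ rfac K t τ, Real.exp (RB (gB K) (uB K v) X - RB (gB K) oneB X)) * (Real.exp (-aB K t τ v) * wB K t τ v))))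
          (μ K t τ))
    (hsc : ∀ K t, |t| ≤ l₀ → ∀ τ ∈ T K \ Bad K t, ∀ X ∈ fac K t τ, C.scale X ≤ K)
    (hoff : ∀ K t, |t| ≤ l₀ → ∀ τ ∈ T K \ Bad K t, ∀ v, v ∉ Adm →
      (∏ X ∈ fac K t τ, Real.exp (EA (gA K) (uA K v) X - EA (gA K) oneA X)) *
        ((∏ X ∈ bfac K t τ, Real.exp (BA (gA K) (uA K v) (pend K t τ v) X)) * nA K t τ v * qA K *
          ((∏ X ∈ rfac K t τ, Real.exp (RA (gA K) (uA K v) X - RA (gA K) oneA X)) * (Real.exp (-aA K t τ v) * wA K t τ v)))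
          = 0 ∧
      (∏ X ∈ fac K t τ, Real.exp (EB (gB K) (uB K v) X - EB (gB K) oneB X)) *
        ((∏ X ∈ bfac K t τ, Real.exp (BB (gB K) (uB K v) (pend K t τ v) X)) * nB K t τ v * qB K *
          ((∏ X ∈ rfac K t τ, Real.exp (RB (gB K) (uB K v) X - RB (gB K) oneB X)) * (Real.exp (-aB K t τ v) * wB K t τ v)))
          = 0)
    (hS : ∀ K t, |t| ≤ l₀ → ∀ τ ∈ T K \ Bad K t, ∀ v ∈ Adm, ∀ j ≤ K,
      |(∑ X ∈ fac K t τ with C.scale X = j,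
          (Real.log (Real.exp (EB (gB K) (uB K v) X - EB (gB K) oneB X))
            - Real.log (Real.exp (EA (gA K) (uA K v) X - EA (gA K) oneA X)))) - κ₁ K t τ j| ≤ S K t τ j)
    (hM : ∀ K t, |t| ≤ l₀ → ∀ τ ∈ T K \ Bad K t,
      Multiplicity (fac K t τ) C.scale (fun X => Real.exp (-(κ * C.d X))) Cw vol Λ K)
    (hwit : ∀ K, ∃ v₁ ∈ Adm, uA K v₁ = oneA ∧ uB K v₁ = oneB)
    (hvol : 0 ≤ vol) (hE : 0 ≤ E) (ha0 : 0 < a) (ha1 : a < 1)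
    (hSle : ∀ K t, |t| ≤ l₀ → ∀ τ ∈ T K \ Bad K t, ∀ j ≤ K, S K t τ j ≤ vol * (E * a ^ (K - j)))
    (hpend : ∀ K t, |t| ≤ l₀ → ∀ τ ∈ T K \ Bad K t, ∀ v ∈ Adm, pend K t τ v ∈ C.admFl)
    (hBwin : ∀ K t, |t| ≤ l₀ → ∀ τ ∈ T K \ Bad K t, RecentOnly (bfac K t τ) C.scale (jlogOf Cl K) K)
    (hMB : ∀ K t, |t| ≤ l₀ → ∀ τ ∈ T K \ Bad K t,
      Multiplicity (bfac K t τ) C.scale (fun X => Real.exp (-(κ * C.d X))) Cw vol Λ K)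
    (hnpos : ∀ K t, |t| ≤ l₀ → ∀ τ ∈ T K \ Bad K t, ∀ v ∈ Adm, 0 < nA K t τ v ∧ 0 < nB K t τ v)
    (hzA : ∀ K t, |t| ≤ l₀ → ∀ τ ∈ T K \ Bad K t, ∀ v ∈ Adm, |Real.log (nA K t τ v)| ≤ vol * zA K)
    (hzB : ∀ K t, |t| ≤ l₀ → ∀ τ ∈ T K \ Bad K t, ∀ v ∈ Adm, |Real.log (nB K t τ v)| ≤ vol * zB K)
    (hzAs : Summable zA) (hzBs : Summable zB)
    (hq : ∀ K, 0 < qA K ∧ 0 < qB K)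
    -- the 𝐑-kind: scales, multiplicity, one-run slice sizes, the flow window of both coupling tables
    (hrsc : ∀ K t, |t| ≤ l₀ → ∀ τ ∈ T K \ Bad K t, ∀ X ∈ rfac K t τ, C.scale X ≤ K)
    (hMR : ∀ K t, |t| ≤ l₀ → ∀ τ ∈ T K \ Bad K t,
      Multiplicity (rfac K t τ) C.scale (fun X => Real.exp (-(κ * C.d X))) Cw vol Λ K)
    (hRSA : ∀ K t, |t| ≤ l₀ → ∀ τ ∈ T K \ Bad K t, ∀ v ∈ Adm, ∀ j ≤ K,
      |∑ X ∈ rfac K t τ with C.scale X = j, (RA (gA K) (uA K v) X - RA (gA K) oneA X)| ≤ vol * (R₁ * gsA K j ^ κ₀))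
    (hRSB : ∀ K t, |t| ≤ l₀ → ∀ τ ∈ T K \ Bad K t, ∀ v ∈ Adm, ∀ j ≤ K,
      |∑ X ∈ rfac K t τ with C.scale X = j, (RB (gB K) (uB K v) X - RB (gB K) oneB X)| ≤ vol * (R₁ * gsB K j ^ κ₀))
    (hb : 0 < b) (h031A : ∀ K, Step.Discrete031 b β' K (gfA K) (gsA K))
    (h031B : ∀ K, Step.Discrete031 b β' K (gfB K) (gsB K)) (hgsA : ∀ K k, k ≤ K → 0 ≤ gsA K k)
    (hgsB : ∀ K k, k ≤ K → 0 ≤ gsB K k) (hR₁ : 0 ≤ R₁) (hκ₀ : 4 < κ₀)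
    -- the ACTION kind from ONE CLASSICAL STEP: (min-A) (Q) (lift) (min-B) (act) (U) (L) (γ)
    (hminA : ∀ K t, |t| ≤ l₀ → ∀ τ ∈ T K \ Bad K t, ∀ v ∈ Adm, IsMinOn (g K t τ v) (SfibA K t τ v) (xA K t τ v))
    (hQ : ∀ K t, |t| ≤ l₀ → ∀ τ ∈ T K \ Bad K t, ∀ v ∈ Adm, Set.MapsTo (Q K t τ v) (Sfib K t τ v) (SfibA K t τ v))
    (hlift : ∀ K t, |t| ≤ l₀ → ∀ τ ∈ T K \ Bad K t, ∀ v ∈ Adm,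
      yA K t τ v ∈ Sfib K t τ v ∧ Q K t τ v (yA K t τ v) = xA K t τ v)
    (hminB : ∀ K t, |t| ≤ l₀ → ∀ τ ∈ T K \ Bad K t, ∀ v ∈ Adm,
      yB K t τ v ∈ Sfib K t τ v ∧ IsMinOn (f₁ K t τ v) (Sfib K t τ v) (yB K t τ v))
    (hact : ∀ K t, |t| ≤ l₀ → ∀ τ ∈ T K \ Bad K t, ∀ v ∈ Adm,
      aA K t τ v = w₀ * g K t τ v (xA K t τ v) + γA K t τ v ∧
        aB K t τ v = w₀ * f₁ K t τ v (yB K t τ v) + γB K t τ v)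
    (hw₀ : 0 ≤ w₀)
    -- (U)(L) PRODUCED (`TermwiseLevels.interpolation_averaging_of_levels`): (wt)(ker)(cnt)(repr-U)(tr-U)(repr-L)(tr-L)
    -- verbatim; (win-U)(win-L)(win-Lf) the WINDOW CLAUSE; (bch-U)(sz-U)(osc-U)(bch-L)(sz-L)(sz-Lf) LEVEL-GRADED; (scal)
    -- per level — in place of generation 9's `hUdev hLdev hdU0 hdL0 hdU hdL`
    (he : ∀ v, ‖v‖ ^ 2 / 2 - q₄ * ‖v‖ ^ 4 ≤ e v ∧ e v ≤ ‖v‖ ^ 2 / 2) (hq₄ : 0 ≤ q₄) (hL : 1 < L)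
    (hw : ∀ K, ∀ y ∈ Pc K, ∀ x ∈ Pf K, 0 ≤ w K y x) (hrow : ∀ K, ∀ y ∈ Pc K, ∑ x ∈ Pf K, w K y x = L ^ 2)
    (hcol : ∀ K, ∀ x ∈ Pf K, ∑ y ∈ Pc K, w K y x = (L ^ 2)⁻¹) (hn₀ : 0 ≤ n₀)
    (hNf : ∀ K, ((Pf K).card : ℝ) ≤ n₀ * vol * (L ^ (K + 1)) ^ 4)
    (hNc : ∀ K, ((Pc K).card : ℝ) ≤ n₀ * vol * (L ^ K) ^ 4)
    (hreprU : ∀ K t, |t| ≤ l₀ → ∀ τ ∈ T K \ Bad K t, ∀ v ∈ Adm,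
      f₁ K t τ v (yA K t τ v) = ∑ x ∈ Pf K, e (φA K t τ v x) ∧
        g K t τ v (xA K t τ v) = ∑ y ∈ Pc K, e (ψA K t τ v y))
    (hΦA : ∀ K t, |t| ≤ l₀ → ∀ τ ∈ T K \ Bad K t, ∀ v ∈ Adm, ∀ y ∈ Pc K, ∀ x ∈ Pf K,
      ‖ΦA K t τ v y x‖ = ‖φA K t τ v x‖)
    (hwinA : ∀ K t, |t| ≤ l₀ → ∀ τ ∈ T K \ Bad K t, ∀ v ∈ Adm, RecentOnly (Pc K) (lvlA K t τ v) (jlogOf Cl K) K)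
    (hρA : ∀ K t, |t| ≤ l₀ → ∀ τ ∈ T K \ Bad K t, ∀ v ∈ Adm, ∀ y ∈ Pc K,
      ‖ψA K t τ v y - ∑ x ∈ Pf K, w K y x • ΦA K t τ v y x‖ ≤ ρb (lvlA K t τ v y))
    (hsA : ∀ K t, |t| ≤ l₀ → ∀ τ ∈ T K \ Bad K t, ∀ v ∈ Adm, ∀ y ∈ Pc K, ∀ x ∈ Pf K,
      0 < w K y x → ‖φA K t τ v x‖ ≤ sz (lvlA K t τ v y))
    (hoscA : ∀ K t, |t| ≤ l₀ → ∀ τ ∈ T K \ Bad K t, ∀ v ∈ Adm, ∀ y ∈ Pc K, ∀ x ∈ Pf K, ∀ x' ∈ Pf K,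
      0 < w K y x → 0 < w K y x' → ‖ΦA K t τ v y x - ΦA K t τ v y x'‖ ≤ ω (lvlA K t τ v y))
    (hreprL : ∀ K t, |t| ≤ l₀ → ∀ τ ∈ T K \ Bad K t, ∀ v ∈ Adm,
      f₁ K t τ v (yB K t τ v) = ∑ x ∈ Pf K, e (φB K t τ v x) ∧
        g K t τ v (Q K t τ v (yB K t τ v)) = ∑ y ∈ Pc K, e (ψB K t τ v y))
    (hΦB : ∀ K t, |t| ≤ l₀ → ∀ τ ∈ T K \ Bad K t, ∀ v ∈ Adm, ∀ y ∈ Pc K, ∀ x ∈ Pf K,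
      ‖ΦB K t τ v y x‖ = ‖φB K t τ v x‖)
    (hwinB : ∀ K t, |t| ≤ l₀ → ∀ τ ∈ T K \ Bad K t, ∀ v ∈ Adm, RecentOnly (Pc K) (lvlB K t τ v) (jlogOf Cl K) K)
    (hwinBf : ∀ K t, |t| ≤ l₀ → ∀ τ ∈ T K \ Bad K t, ∀ v ∈ Adm,
      RecentOnly (Pf K) (lvlBf K t τ v) (jlogOf Cl K) K)
    (hρB : ∀ K t, |t| ≤ l₀ → ∀ τ ∈ T K \ Bad K t, ∀ v ∈ Adm, ∀ y ∈ Pc K,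
      ‖ψB K t τ v y - ∑ x ∈ Pf K, w K y x • ΦB K t τ v y x‖ ≤ ρb (lvlB K t τ v y))
    (hsB : ∀ K t, |t| ≤ l₀ → ∀ τ ∈ T K \ Bad K t, ∀ v ∈ Adm, ∀ y ∈ Pc K, ∀ x ∈ Pf K,
      0 < w K y x → ‖φB K t τ v x‖ ≤ sz (lvlB K t τ v y))
    (hsBf : ∀ K t, |t| ≤ l₀ → ∀ τ ∈ T K \ Bad K t, ∀ v ∈ Adm, ∀ x ∈ Pf K, ‖φB K t τ v x‖ ≤ sz (lvlBf K t τ v x))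
    (hc₁ : 0 ≤ c₁) (hc₃ : 0 ≤ c₃) (hε₁ : 0 ≤ ε₁)
    (hsz : ∀ j, 0 ≤ sz j ∧ sz j ≤ c₁ * ε₁ * ((L ^ (j + 1))⁻¹) ^ 2)
    (hω : ∀ j, 0 ≤ ω j ∧ ω j ≤ c₂ * ε₁ * ((L ^ (j + 1))⁻¹) ^ 2 * (L ^ j)⁻¹)
    (hρb : ∀ j, 0 ≤ ρb j ∧ ρb j ≤ c₃ * ε₁ ^ 2 * ((L ^ j)⁻¹) ^ 4)
    (hγ : ∀ K t, |t| ≤ l₀ → ∀ τ ∈ T K \ Bad K t, ∀ v ∈ Adm, |γB K t τ v - γA K t τ v| ≤ vol * rγ K)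
    (hrγ : Summable rγ)
    -- the residual kind after generation 8: (R-w) radii about a centre `cW`, (W-w) the WITNESS log-ratio centred
    (hwpos : ∀ K t, |t| ≤ l₀ → ∀ τ ∈ T K \ Bad K t, ∀ v ∈ Adm, 0 < wA K t τ v ∧ 0 < wB K t τ v)
    (hRw : ∀ K t, |t| ≤ l₀ → ∀ τ ∈ T K \ Bad K t, ∀ v ∈ Adm,
      |Real.log (wB K t τ v) - Real.log (wA K t τ v) - cW K t τ| ≤ RW K t τ)
    (hRRw : ∀ K t, |t| ≤ l₀ → ∀ τ ∈ T K \ Bad K t, RW K t τ ≤ vol * rw K) (hrw : Summable rw)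
    (hWw : ∀ K t, |t| ≤ l₀ → ∀ τ ∈ T K \ Bad K t, ∀ v ∈ Adm, uA K v = oneA → uB K v = oneB →
      |Real.log (wB K t τ v) - Real.log (wA K t τ v) - c₀ K| ≤ vol * sw K)
    (hsw : Summable sw) :
    GoodClause l₀ vol T A B Bad
        (fun K => (max Cw 1 * ((E + Cr) * ∑ x ∈ antidiagonal K, min (a ^ x.2) (θ' ^ x.1 * Λ ^ x.2))
            + (EB₀ * Cw * windowSum θ' Λ (jlogOf Cl K) K + (zA K + zB K)
              + (max (2 * Cw) 1 * ((∑ p ∈ antidiagonal K, min (R₁ * gsA K p.1 ^ κ₀) (CrR * θ' ^ p.1 * Λ ^ p.2))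
                  + ∑ p ∈ antidiagonal K, min (R₁ * gsB K p.1 ^ κ₀) (CrR * θ' ^ p.1 * Λ ^ p.2))
                + (w₀ * (n₀ * cU q₄ c₁ c₂ c₃ ε₁ * windowSum ((L ^ 2)⁻¹) (L ^ 4) (jlogOf Cl K) K
                  + n₀ * (c₁ * c₃ * ε₁ ^ 3 + c₃ ^ 2 * ε₁ ^ 4 / 2 + q₄ * (c₁ ^ 4 * ε₁ ^ 4))
                    * windowSum ((L ^ 2)⁻¹) (L ^ 4) (jlogOf Cl K) K)
                  + rγ K + rw K))))
          + (max Cw 1 * ((E + Cr) * ∑ x ∈ antidiagonal K, min (a ^ x.2) (θ' ^ x.1 * Λ ^ x.2)) + (rw K + sw K))) ∧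
      Summable (fun K => (max Cw 1 * ((E + Cr) * ∑ x ∈ antidiagonal K, min (a ^ x.2) (θ' ^ x.1 * Λ ^ x.2))
            + (EB₀ * Cw * windowSum θ' Λ (jlogOf Cl K) K + (zA K + zB K)
              + (max (2 * Cw) 1 * ((∑ p ∈ antidiagonal K, min (R₁ * gsA K p.1 ^ κ₀) (CrR * θ' ^ p.1 * Λ ^ p.2))
                  + ∑ p ∈ antidiagonal K, min (R₁ * gsB K p.1 ^ κ₀) (CrR * θ' ^ p.1 * Λ ^ p.2))
                + (w₀ * (n₀ * cU q₄ c₁ c₂ c₃ ε₁ * windowSum ((L ^ 2)⁻¹) (L ^ 4) (jlogOf Cl K) K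
                  + n₀ * (c₁ * c₃ * ε₁ ^ 3 + c₃ ^ 2 * ε₁ ^ 4 / 2 + q₄ * (c₁ ^ 4 * ε₁ ^ 4))
                    * windowSum ((L ^ 2)⁻¹) (L ^ 4) (jlogOf Cl K) K)
                  + rγ K + rw K))))
          + (max Cw 1 * ((E + Cr) * ∑ x ∈ antidiagonal K, min (a ^ x.2) (θ' ^ x.1 * Λ ^ x.2)) + (rw K + sw K))) := by
  obtain ⟨hUdev, hLdev, hdU0, hdL0, hdU, hdL⟩ := interpolation_averaging_of_levels (l₀ := l₀) (T := T) (Bad := Bad)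
    (Adm := Adm) he hq₄ hL hw hrow hcol hn₀ hvol hNf hNc hreprU hΦA hwinA hρA hsA hoscA hreprL hΦB hwinB hwinBf hρB hsB
    hsBf hc₁ hc₃ hε₁ hCl hsz hω hρb
  exact goodClause_summable_of_kindsRA_lift hUR hCr hθ'0 hθ'1 hθ'Λ hΛ1 hCl hURB hEB₀ hURR hCrR hfmtA hfmtB hint hsc
    hoff hS hM hwit hvol hE ha0 ha1 hSle hpend hBwin hMB hnpos hzA hzB hzAs hzBs hq hrsc hMR hRSA hRSB hb h031A h031B
    hgsA hgsB hR₁ hκ₀ hminA hQ hlift hminB hact hw₀ hUdev hLdev hdU0 hdL0 hdU hdL hγ hrγ hwpos hRw hRRw hrw hWw hsw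

end Ledger

end Summit.QuantumFields.BalabanUV.T4Continuum.TermwiseLevels
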